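import Literature.Analysis.FluidPDE.LeiZhang2011Cutoff
import Literature.Analysis.FluidPDE.AxisymmetricEuler
import Mathlib.Analysis.SpecialFunctions.Pow.Deriv
import HarnessLib

/-!
# SwirlFreeBudget, crux K-18.1 `EtaMoserBound`, step A.5: the convex profiles
# `H_λ(η) = (λ² + η²)^m` and the cut-offs of the reverse Hölder step (seat nsreg-p4 g13)

Support file for the DORMANT route `SwirlThreshold` (crux stmt-NavierStokesRegularity-2002) and
planner nsreg-p2's ROUND-18 Appendix A (`R18-APPENDIX-EtaMoser.md`, §A.2: "Multiply (A.1) by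
`2m|η|^{2m−2}η φ²` … at `η = 0` use `(η²+ε)^{m−1}η` and let `ε → 0`", §A.3 the cut-off weights).
The data fed to the abstract energy method (siblings `…SwirlFreeBudgetEtaEnergyInequality`,
`…EtaDrift`, `…EtaAbsorbed`, `…EtaTenThirds`):

* `etaProfile_props` — for real `m ≥ 1` and `λ > 0` the profile `s(v) = (λ² + v²)^{m/2}`,
  `H = s² = (λ² + v²)^m` is admissible: `s ∈ C¹`, `H ∈ C²`, `s ≥ 0`, `2s'² ≤ H''`, `H'² ≤ 2HH''`
  (both differences equal a positive multiple of `λ² + (m−1)v²`), and `|v|^m ≤ s(v)`,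
  `H(v) ≤ (1 + v²)^m` for `λ ≤ 1`;
* `etaTimeCutoff_props` — the time factor `χ(s) = smoothTransition(((s − t₁) + ϱ₁²)/(ϱ₁² − ϱ²))`:
  `C¹`, `χ(t₁ − ϱ₁²) = 0`, `χ = 1` on `[t₁ − ϱ², ∞)`, `0 ≤ χ ≤ 1`, `|χ'| ≤ C_T/(ϱ₁² − ϱ²)`;
* `etaSpaceCutoff_props` — the space factor `ψ(x) = radialCutoff ϱ ϱ₁ (x − c)` about an axis point
  `c`, `Θ = ψ²`, and the radial derivative quotient `q` of `Θ²` (`x₀ q = ∂₀(Θ²)`,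
  `q = −8 κ ψ³ smoothTransition'(κ(ϱ₁² − |x−c|²))`, `κ = (ϱ₁²−ϱ²)⁻¹`): smoothness, `0 ≤ ψ ≤ 1`,
  `ψ = 1` on `B(c, ϱ)`, `tsupport ψ ⊆ B̄(c, ϱ₁)`, `‖∇ψ‖ ≤ C₁/(ϱ₁ − ϱ)`, axisymmetry of `ψ, Θ, q`,
  `q` continuous, supported in `B̄(c, ϱ₁)`, `|q| ≤ 8C_T/(ϱ₁² − ϱ²)` (memo A.3:
  `|(2/r)∂_r(φ²)| ≤ 8N/(ϱ′−ϱ)²`).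

WHAT THIS IS NOT: not NS regularity — calculus; `EtaMoserBound` stays OPEN here; no crux claim.
-/

-- the problem directory repeats the summit name (D-0017); core's `dupNamespace` linter fires
set_option linter.dupNamespace false

namespace Summit.NavierStokesRegularity.NavierStokesRegularity.Theorems.SwirlFreeBudget

open MeasureTheory Set Filter Topology Metric Function
open scoped RealInnerProductSpace ContDiff
open Literature.Analysis Literature.Analysis.FluidPDE

noncomputable section

/-! ### The profiles `s_λ(v) = (λ² + v²)^{m/2}`, `H_λ = s_λ²` -/

/-- **The regularised convex powers of the Moser step for `η`.**  For real `m ≥ 1` and `λ > 0`,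
with `s(v) = (λ² + v²)^{m/2}` and `H(v) = (λ² + v²)^m`: `s ∈ C¹`, `H ∈ C²`, `s ≥ 0`, `H = s²`,
`2 s'² ≤ H''`, `H'² ≤ 2 H H''` (the hypotheses of the convex-function form of the energy
inequality with `κ = 2`; `H'' − 2s'² = 2m(λ²+v²)^{m−2}(λ² + (m−1)v²)` and
`2HH'' − H'² = 4m(λ²+v²)^{2m−2}(λ² + (m−1)v²)`), `|v|^m ≤ s(v)`, and `H(v) ≤ (1+v²)^m` when `λ ≤ 1`. -/
theorem etaProfile_props {m : ℝ} (hm : 1 ≤ m) {lam : ℝ} (hlam : 0 < lam) {sf H : ℝ → ℝ}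
    (hsf : ∀ v, sf v = (lam ^ 2 + v ^ 2) ^ (m / 2)) (hH : ∀ v, H v = (lam ^ 2 + v ^ 2) ^ m) :
    ContDiff ℝ 1 sf ∧ ContDiff ℝ 2 H ∧ (∀ v, 0 ≤ sf v) ∧ (∀ v, H v = sf v ^ 2) ∧
      (∀ v, 2 * deriv sf v ^ 2 ≤ deriv (deriv H) v) ∧
      (∀ v, deriv H v ^ 2 ≤ 2 * H v * deriv (deriv H) v) ∧
      (∀ v, |v| ^ m ≤ sf v) ∧ (lam ≤ 1 → ∀ v, H v ≤ (1 + v ^ 2) ^ m) := by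
  have hsfun : sf = fun v => (lam ^ 2 + v ^ 2) ^ (m / 2) := funext hsf
  have hHfun : H = fun v => (lam ^ 2 + v ^ 2) ^ m := funext hH
  have hu : ∀ v : ℝ, 0 < lam ^ 2 + v ^ 2 := fun v => by positivity
  have hune : ∀ v : ℝ, lam ^ 2 + v ^ 2 ≠ 0 := fun v => (hu v).ne'
  have cu : ContDiff ℝ ⊤ fun v : ℝ => lam ^ 2 + v ^ 2 := contDiff_const.add (contDiff_id.pow 2)
  have hdu : ∀ v : ℝ, HasDerivAt (fun v : ℝ => lam ^ 2 + v ^ 2) (2 * v) v := fun v => by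
    simpa using ((hasDerivAt_pow 2 v).const_add (lam ^ 2))
  -- derivatives
  have hds : ∀ v, HasDerivAt sf (2 * v * (m / 2) * (lam ^ 2 + v ^ 2) ^ (m / 2 - 1)) v := fun v => by
    rw [hsfun]; exact (hdu v).rpow_const (Or.inl (hune v))
  have hdH : ∀ v, HasDerivAt H (2 * v * m * (lam ^ 2 + v ^ 2) ^ (m - 1)) v := fun v => by
    rw [hHfun]; exact (hdu v).rpow_const (Or.inl (hune v))
  have hH'fun : deriv H = fun v => 2 * v * m * (lam ^ 2 + v ^ 2) ^ (m - 1) := funext fun v => (hdH v).deriv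
  have hdH' : ∀ v, HasDerivAt (deriv H) (2 * m * (lam ^ 2 + v ^ 2) ^ (m - 1) +
      2 * v * m * (2 * v * (m - 1) * (lam ^ 2 + v ^ 2) ^ (m - 1 - 1))) v := by
    intro v
    rw [hH'fun]
    have h1 : HasDerivAt (fun v : ℝ => 2 * v * m) (2 * m) v := by
      have := ((hasDerivAt_id v).const_mul 2).mul_const m
      simpa using this
    have h2 : HasDerivAt (fun v : ℝ => (lam ^ 2 + v ^ 2) ^ (m - 1)) (2 * v * (m - 1) * (lam ^ 2 + v ^ 2) ^ (m - 1 - 1)) v :=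
      (hdu v).rpow_const (Or.inl (hune v))
    have h := h1.mul h2
    refine h.congr_deriv ?_
    ring
  -- the algebra: `A = u^{m-2}`, `u^{m-1} = u A`, `u^m = u² A`, `(u^{m/2-1})² = A`
  have hkey : ∀ v, 2 * deriv sf v ^ 2 ≤ deriv (deriv H) v ∧ deriv H v ^ 2 ≤ 2 * H v * deriv (deriv H) v := by
    intro v
    set u : ℝ := lam ^ 2 + v ^ 2 with hu_def
    have hu0 : 0 < u := hu v
    set A : ℝ := u ^ (m - 2) with hA
    have hA0 : 0 ≤ A := Real.rpow_nonneg hu0.le _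
    have e1 : u ^ (m - 1) = u * A := by
      rw [hA, show m - 1 = (m - 2) + 1 by ring, Real.rpow_add hu0, Real.rpow_one]; ring
    have e2 : u ^ m = u ^ 2 * A := by
      rw [hA, show m = (m - 2) + 2 by ring, Real.rpow_add hu0, show (m - 2 + 2 - 2) = m - 2 by ring]
      rw [show ((2 : ℝ)) = ((2 : ℕ) : ℝ) by norm_num, Real.rpow_natCast]; ring
    have e3 : (u ^ (m / 2 - 1)) ^ 2 = A := by
      rw [hA, ← Real.rpow_natCast, ← Real.rpow_mul hu0.le]; norm_num; ring_nf
    have e4 : u ^ (m - 1 - 1) = A := by rw [hA]; ring_nf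
    rw [(hds v).deriv, (hdH' v).deriv, (hdH v).deriv, hH v, ← hu_def, e1, e4, e2]
    have hm0 : 0 ≤ m := le_trans zero_le_one hm
    have hcore : 0 ≤ lam ^ 2 + (m - 1) * v ^ 2 := by nlinarith [sq_nonneg v, sq_nonneg lam]
    constructor
    · rw [mul_pow, mul_pow, mul_pow, e3]
      have : 0 ≤ 2 * m * A * (lam ^ 2 + (m - 1) * v ^ 2) := by positivity
      nlinarith [this]
    · have : 0 ≤ 4 * m * u ^ 2 * A ^ 2 * (lam ^ 2 + (m - 1) * v ^ 2) := by positivity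
      nlinarith [this]
  refine ⟨?_, ?_, fun v => ?_, fun v => ?_, fun v => (hkey v).1, fun v => (hkey v).2, fun v => ?_, fun hl v => ?_⟩
  · rw [hsfun]; exact (cu.of_le le_top).rpow_const_of_ne fun v => hune v
  · rw [hHfun]; exact (cu.of_le le_top).rpow_const_of_ne fun v => hune v
  · rw [hsf]; exact Real.rpow_nonneg (hu v).le _
  · rw [hH, hsf, ← Real.rpow_natCast ((lam ^ 2 + v ^ 2) ^ (m / 2)) 2, ← Real.rpow_mul (hu v).le]
    norm_num
  · rw [hsf, show |v| ^ m = (|v| ^ (2 : ℝ)) ^ (m / 2) by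
      rw [← Real.rpow_mul (abs_nonneg v)]; ring_nf]
    refine Real.rpow_le_rpow (by positivity) ?_ (by linarith)
    rw [show (2 : ℝ) = (2 : ℕ) by norm_num, Real.rpow_natCast, sq_abs]
    nlinarith [sq_nonneg lam]
  · rw [hH]
    refine Real.rpow_le_rpow (hu v).le ?_ (le_trans zero_le_one hm)
    nlinarith

/-- Along `λ → 0⁺` the profiles decrease to the power: `(λ² + v²)^m → |v|^{2m}`. -/
theorem tendsto_etaProfile {m : ℝ} (hm : 1 ≤ m) (v : ℝ) :
    Tendsto (fun lam : ℝ => (lam ^ 2 + v ^ 2) ^ m) (𝓝 0) (𝓝 (|v| ^ (2 * m))) := by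
  have hc : Continuous fun lam : ℝ => (lam ^ 2 + v ^ 2) ^ m :=
    (continuous_id.pow 2 |>.add continuous_const).rpow_const fun _ => Or.inr (by linarith)
  have h := hc.tendsto 0
  have e : ((0 : ℝ) ^ 2 + v ^ 2) ^ m = |v| ^ (2 * m) := by
    rw [Real.rpow_mul (abs_nonneg v), show (2 : ℝ) = (2 : ℕ) by norm_num, Real.rpow_natCast, sq_abs]
    ring_nf
  rwa [e] at h

/-! ### The time cut-off -/

/-- **The time factor of the reverse Hölder step**: `χ(s) = smoothTransition(((s − t₁) + ϱ₁²)/(ϱ₁² − ϱ²))`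
for `0 ≤ ϱ < ϱ₁` vanishes at `t₁ − ϱ₁²`, equals `1` on `[t₁ − ϱ², ∞)`, takes values in `[0, 1]`,
is `C¹`, and `|χ'| ≤ C_T/(ϱ₁² − ϱ²)` (`C_T` a bound for `smoothTransition'`). -/
theorem etaTimeCutoff_props {t₁ ϱ ϱ₁ : ℝ} (hϱ : 0 ≤ ϱ) (hϱϱ₁ : ϱ < ϱ₁) {CT : ℝ}
    (hCT : ∀ t, |deriv Real.smoothTransition t| ≤ CT) {χ : ℝ → ℝ}
    (hχ : ∀ s, χ s = Real.smoothTransition (((s - t₁) + ϱ₁ ^ 2) / (ϱ₁ ^ 2 - ϱ ^ 2))) :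
    ContDiff ℝ 1 χ ∧ χ (t₁ - ϱ₁ ^ 2) = 0 ∧ (∀ s, t₁ - ϱ ^ 2 ≤ s → χ s = 1) ∧
      (∀ s, 0 ≤ χ s ∧ χ s ≤ 1) ∧ (∀ s, |deriv χ s| ≤ CT / (ϱ₁ ^ 2 - ϱ ^ 2)) := by
  have hT : ϱ ^ 2 < ϱ₁ ^ 2 := by nlinarith
  obtain ⟨hC, h0, h1, h01, hd⟩ := LeiZhang2011.timeCutoff_props hT hCT
  set χ₀ : ℝ → ℝ := fun s => Real.smoothTransition ((s + ϱ₁ ^ 2) / (ϱ₁ ^ 2 - ϱ ^ 2)) with hχ₀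
  have hcomp : χ = fun s => χ₀ (s - t₁) := funext fun s => by rw [hχ s]
  refine ⟨?_, ?_, fun s hs => ?_, fun s => ?_, fun s => ?_⟩
  · rw [hcomp]; exact hC.comp (contDiff_id.sub contDiff_const)
  · rw [hχ, show t₁ - ϱ₁ ^ 2 - t₁ + ϱ₁ ^ 2 = -ϱ₁ ^ 2 + ϱ₁ ^ 2 by ring]; exact h0
  · rw [hcomp]; exact h1 (s - t₁) (by linarith)
  · rw [hcomp]; exact h01 (s - t₁)
  · have hdiff : Differentiable ℝ χ₀ := hC.differentiable one_ne_zero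
    have hder : HasDerivAt χ (deriv χ₀ (s - t₁)) s := by
      rw [hcomp]
      exact HasDerivAt.comp_sub_const s t₁ (hdiff (s - t₁)).hasDerivAt
    rw [hder.deriv]
    exact hd (s - t₁)

/-! ### The space cut-off about an axis point and the weight `q` -/

/-- The radial cut-off about an axis point is invariant under the rotations about the axis. -/
theorem radialCutoff_sub_rotZ_of_axis {c : EuclideanSpace ℝ (Fin 3)} (hc : c 0 = 0 ∧ c 1 = 0)
    (ρ₁ ρ₂ θ : ℝ) (y : EuclideanSpace ℝ (Fin 3)) :
    radialCutoff ρ₁ ρ₂ (rotZ θ y - c) = radialCutoff ρ₁ ρ₂ (y - c) := by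
  have h1 : rotZ θ c = c := by
    ext i
    fin_cases i <;> simp [hc.1, hc.2]
  have h2 : rotZ θ y - c = rotZ θ (y - c) := by
    conv_lhs => rw [← h1]
    rw [← rotZL_apply, ← rotZL_apply, ← rotZL_apply, map_sub]
  exact radialCutoff_radial ρ₁ ρ₂ (by rw [h2, norm_rotZ])

/-- **The space cut-off of the reverse Hölder step and its radial derivative quotient.**  For
`c` on the axis, `0 ≤ ϱ < ϱ₁`, `ψ(x) = radialCutoff ϱ ϱ₁ (x − c)`, `Θ = ψ²` and
`q(x) = −8κ ψ(x)³ smoothTransition'(κ(ϱ₁² − |x − c|²))`, `κ = (ϱ₁² − ϱ²)⁻¹`: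
`ψ ∈ C¹`, `0 ≤ ψ ≤ 1`, `ψ = 1` on `B(c, ϱ)`, `tsupport ψ ⊆ B̄(c, ϱ₁)`, `‖∇ψ‖ ≤ C₁/(ϱ₁ − ϱ)`;
`ψ`, `Θ`, `q` are axisymmetric; `q` is continuous, vanishes off `B̄(c, ϱ₁)`, `|q| ≤ 8C_T κ`, and
`x₀ q(x) = ∂₀(Θ²)(x)` (`∂₀(ψ⁴) = 4ψ³∂₀ψ`, `∂₀ψ(x) = −2κ smoothTransition'(…)(x₀ − c₀)`, `c₀ = 0`). -/
theorem etaSpaceCutoff_props {c : EuclideanSpace ℝ (Fin 3)} (hc : c 0 = 0 ∧ c 1 = 0) {ϱ ϱ₁ : ℝ}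
    (hϱ : 0 ≤ ϱ) (hϱϱ₁ : ϱ < ϱ₁) {CT : ℝ} (hCT : ∀ t, |deriv Real.smoothTransition t| ≤ CT)
    {C₁ : ℝ} (hC₁ : ∀ (ρ₂ ρ₁ : ℝ), 0 ≤ ρ₂ → ρ₂ < ρ₁ → ∀ z : EuclideanSpace ℝ (Fin 3),
      ‖gradient (radialCutoff ρ₂ ρ₁ : EuclideanSpace ℝ (Fin 3) → ℝ) z‖ ≤ C₁ / (ρ₁ - ρ₂))
    {ψ Θ q : EuclideanSpace ℝ (Fin 3) → ℝ} (hψ : ∀ x, ψ x = radialCutoff ϱ ϱ₁ (x - c))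
    (hΘ : ∀ x, Θ x = ψ x ^ 2)
    (hq : ∀ x, q x = -8 * (ϱ₁ ^ 2 - ϱ ^ 2)⁻¹ * ψ x ^ 3 *
      deriv Real.smoothTransition ((ϱ₁ ^ 2 - ϱ ^ 2)⁻¹ * (ϱ₁ ^ 2 - ‖x - c‖ ^ 2))) :
    ContDiff ℝ 1 ψ ∧ (∀ x, 0 ≤ ψ x) ∧ (∀ x, ψ x ≤ 1) ∧ (∀ x ∈ ball c ϱ, ψ x = 1) ∧
      tsupport ψ ⊆ closedBall c ϱ₁ ∧ (∀ x, ‖gradient ψ x‖ ≤ C₁ / (ϱ₁ - ϱ)) ∧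
      IsAxisymmetricScalar ψ ∧ IsAxisymmetricScalar Θ ∧ IsAxisymmetricScalar q ∧
      Continuous q ∧ (∀ x, x ∉ closedBall c ϱ₁ → q x = 0) ∧
      (∀ x, |q x| ≤ 8 * CT * (ϱ₁ ^ 2 - ϱ ^ 2)⁻¹) ∧
      (∀ x : EuclideanSpace ℝ (Fin 3), x 0 * q x = fderiv ℝ (fun y => Θ y ^ 2) x (EuclideanSpace.single 0 1)) := by
  set κ : ℝ := (ϱ₁ ^ 2 - ϱ ^ 2)⁻¹ with hκ
  have hd : 0 < ϱ₁ ^ 2 - ϱ ^ 2 := by nlinarith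
  have hκ0 : 0 < κ := inv_pos.2 hd
  have hψfun : ψ = fun x => radialCutoff ϱ ϱ₁ (x - c) := funext hψ
  have hΘfun : Θ = fun x => ψ x ^ 2 := funext hΘ
  have hqfun : q = fun x => -8 * κ * ψ x ^ 3 * deriv Real.smoothTransition (κ * (ϱ₁ ^ 2 - ‖x - c‖ ^ 2)) :=
    funext fun x => by rw [hq]
  have hCT0 : 0 ≤ CT := (abs_nonneg _).trans (hCT 0)
  -- smoothness and range
  have hψC : ContDiff ℝ 1 ψ := by
    rw [hψfun]
    exact (radialCutoff_contDiff (E' := EuclideanSpace ℝ (Fin 3)) ϱ ϱ₁).comp (contDiff_id.sub contDiff_const)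
  have hψ0 : ∀ x, 0 ≤ ψ x := fun x => by rw [hψ]; exact radialCutoff_nonneg _ _ _
  have hψ1 : ∀ x, ψ x ≤ 1 := fun x => by rw [hψ]; exact radialCutoff_le_one _ _ _
  have hψone : ∀ x ∈ ball c ϱ, ψ x = 1 := fun x hx => by
    rw [hψ]
    exact radialCutoff_eq_one hϱ hϱϱ₁ (by rw [← dist_eq_norm]; exact (mem_ball.1 hx).le)
  have hψzero : ∀ x, x ∉ closedBall c ϱ₁ → ψ x = 0 := fun x hx => by
    rw [hψ]
    refine radialCutoff_eq_zero hϱ hϱϱ₁ ?_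
    rw [← dist_eq_norm]
    exact (not_le.1 fun h => hx (mem_closedBall.2 h)).le
  have hψsupp : tsupport ψ ⊆ closedBall c ϱ₁ :=
    closure_minimal (fun x hx => by by_contra h; exact hx (hψzero x h)) isClosed_closedBall
  -- the derivative of `ψ`
  have hDψ : ∀ x, HasFDerivAt ψ (fderiv ℝ (radialCutoff ϱ ϱ₁ : EuclideanSpace ℝ (Fin 3) → ℝ) (x - c)) x := by
    intro x
    rw [hψfun]
    have hd : DifferentiableAt ℝ (radialCutoff ϱ ϱ₁ : EuclideanSpace ℝ (Fin 3) → ℝ) (x - c) :=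
      (LeiZhang2011.hasFDerivAt_radialCutoff ϱ ϱ₁ (x - c)).differentiableAt
    have h := hd.hasFDerivAt.comp x ((hasFDerivAt_id x).sub_const c)
    rw [ContinuousLinearMap.comp_id] at h
    exact h
  have hgradψ : ∀ x, ‖gradient ψ x‖ ≤ C₁ / (ϱ₁ - ϱ) := by
    intro x
    have h := hC₁ ϱ ϱ₁ hϱ hϱϱ₁ (x - c)
    rw [gradient, LinearIsometryEquiv.norm_map] at h ⊢
    rwa [(hDψ x).fderiv]
  -- axisymmetry
  have hψax : IsAxisymmetricScalar ψ := fun θ x => by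
    rw [hψ, hψ]; exact radialCutoff_sub_rotZ_of_axis hc ϱ ϱ₁ θ x
  have hΘax : IsAxisymmetricScalar Θ := fun θ x => by rw [hΘ, hΘ, hψax θ x]
  have hnorm : ∀ θ x, ‖rotZ θ x - c‖ = ‖x - c‖ := by
    intro θ x
    have h1 : rotZ θ c = c := by
      ext i
      fin_cases i <;> simp [hc.1, hc.2]
    conv_lhs => rw [← h1]
    rw [← rotZL_apply, ← rotZL_apply, ← map_sub, rotZL_apply, norm_rotZ]
  have hqax : IsAxisymmetricScalar q := fun θ x => by rw [hq, hq, hψax θ x, hnorm θ x]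
  -- `q`: continuity, support, bound
  have cST' : Continuous (deriv Real.smoothTransition) :=
    (Real.smoothTransition.contDiff (n := 1)).continuous_deriv le_rfl
  have hqc : Continuous q := by
    rw [hqfun]
    refine ((continuous_const.mul (hψC.continuous.pow 3)).mul (cST'.comp ?_))
    exact continuous_const.mul (continuous_const.sub ((continuous_id.sub continuous_const).norm.pow 2))
  have hq0 : ∀ x, x ∉ closedBall c ϱ₁ → q x = 0 := fun x hx => by rw [hq, hψzero x hx]; ring
  have hqb : ∀ x, |q x| ≤ 8 * CT * (ϱ₁ ^ 2 - ϱ ^ 2)⁻¹ := by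
    intro x
    rw [hq, ← hκ]
    have h1 : |ψ x ^ 3| ≤ 1 := by
      rw [abs_of_nonneg (pow_nonneg (hψ0 x) 3)]
      exact pow_le_one₀ (hψ0 x) (hψ1 x)
    have h2 := hCT (κ * (ϱ₁ ^ 2 - ‖x - c‖ ^ 2))
    rw [abs_mul, abs_mul, abs_mul, abs_of_pos hκ0, show |(-8 : ℝ)| = 8 by norm_num]
    have h3 : 0 ≤ |deriv Real.smoothTransition (κ * (ϱ₁ ^ 2 - ‖x - c‖ ^ 2))| := abs_nonneg _
    calc 8 * κ * |ψ x ^ 3| * |deriv Real.smoothTransition (κ * (ϱ₁ ^ 2 - ‖x - c‖ ^ 2))|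
        ≤ 8 * κ * 1 * CT := by gcongr
      _ = 8 * CT * κ := by ring
  -- the radial derivative quotient of `Θ² = ψ⁴`
  have hqrad : ∀ x : EuclideanSpace ℝ (Fin 3), x 0 * q x = fderiv ℝ (fun y => Θ y ^ 2) x (EuclideanSpace.single 0 1) := by
    intro x
    have hΘ4 : (fun y => Θ y ^ 2) = fun y => ψ y ^ 4 := by
      funext y; rw [hΘ]; ring
    have hψd : DifferentiableAt ℝ ψ x := (hDψ x).differentiableAt
    have h4 : HasFDerivAt (fun y => ψ y ^ 4) ((4 * ψ x ^ 3) • fderiv ℝ ψ x) x := by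
      have := hψd.hasFDerivAt.pow 4
      simpa using this
    have hin : ⟪x - c, EuclideanSpace.single (0 : Fin 3) (1 : ℝ)⟫ = x 0 := by
      rw [EuclideanSpace.inner_single_right]
      simp [hc.1]
    have hDψ0 : fderiv ℝ ψ x (EuclideanSpace.single 0 1) =
        deriv Real.smoothTransition (κ * (ϱ₁ ^ 2 - ‖x - c‖ ^ 2)) * (κ * (-(2 * x 0))) := by
      rw [(hDψ x).fderiv, (LeiZhang2011.hasFDerivAt_radialCutoff ϱ ϱ₁ (x - c)).fderiv]
      simp only [_root_.smul_apply, _root_.neg_apply, innerSL_apply_apply, smul_eq_mul, hin, ← hκ]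
    rw [hΘ4, h4.fderiv, _root_.smul_apply, smul_eq_mul, hDψ0, hq]
    ring
  exact ⟨hψC, hψ0, hψ1, hψone, hψsupp, hgradψ, hψax, hΘax, hqax, hqc, hq0, hqb, hqrad⟩

end

end Summit.NavierStokesRegularity.NavierStokesRegularity.Theorems.SwirlFreeBudget
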